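import Literature.NumberTheory.LFunctions.LagariasDifferencedXiCharProofs
import Literature.NumberTheory.LFunctions.RHInvZetaBound
import Mathlib.Analysis.Complex.BorelCaratheodory
import HarnessLib

/-!
# Lagarias 2005, §5: Lemma 5.1 (2) and Theorem 5.1 (2) — the GRH-conditional half (PROVED, binder kept)

LABEL (line 1): **GRH(χ)-CONDITIONAL records** — every theorem of the §5 block below carries the
explicit hypothesis `χ.RiemannHypothesis` (the Riemann hypothesis for `L(s, χ)`, tree
`DirichletCharacter.RiemannHypothesis`, `GeneralizedRH.lean`), exactly as printed ("Assuming the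
Riemann hypothesis holds for `ξ(s, χ)`"); the binder is never dropped and never asserted. The tools
that do not mention it are RH-FREE. This file discharges the two conditional §5 named facts typed in
`LagariasDifferencedXiSpacings.lean` (cell rh-crit/dbl, corpus C2, source S5), completing Lagarias'
Lemma 5.1 and Theorem 5.1 in the kernel (part (1) of each: `LagariasDifferencedXiCharProofs.lean`):

* `Literature.NumberTheory.LFunctions.lagarias2005_lemma_5_1_2` — **Lemma 5.1 (2)**: assuming the
  Riemann hypothesis for `ξ(s, χ)` (`χ` primitive, non-principal), `|E_h(s, χ)| > |E_h(1 − s̄, χ)|` on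
  `Re(s) > ½` for every `h > 0` (`E_h(s, χ) = ξ(s + h, χ)`);
* `Literature.NumberTheory.LFunctions.lagarias2005_thm_5_1_2` — **Theorem 5.1 (2)**: under the same
  hypothesis, for `0 < |h| < ½` and `0 ≤ θ < 2π` the zeros of `A_{h,θ}(s, χ)`, `B_{h,θ}(s, χ)` lie on
  `Re(s) = ½`, are simple, and interlace.

Source: J. C. Lagarias, *Zero spacing distributions for differenced L-functions*, Acta Arith. 120 (2005)
159–184 = arXiv:math/0601653 [Lagarias2005], §5 (held text `paper:arxiv-math_0601653` p0010: Lemma 5.1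
L28–36, proof L38–72; Theorem 5.1 L85–104). bears_on: LADDER-RH B-C/B-P (COLUMN 6, de Branges).
WHAT THIS IS NOT: a conditional statement about differenced Dirichlet `L`-functions, proved with its
condition as a hypothesis; not progress toward RH or GRH; nothing here bears on the truth of RH.

## The printed proof and the deviation

Lagarias: "Assuming the Riemann hypothesis holds for `ξ(s, χ)`, then the inequality (5.3) is valid for
all nonzero `h`" [typed with `h > 0`: for `h < 0` it reverses, see the statements module], by the
zero-by-zero comparison in the modified Hadamard product (5.4), every zero now having `β = ½ < ½ + h`.
The tree has no Hadamard product for `ξ(s, χ)` (GAP-LEDGER G-dbl-15), so — as for part (1) — the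
inequality `|ξ(s − h, χ)| < |ξ(s + h, χ)|` (`Re s > ½`) is obtained from the Phragmén–Lindelöf principle
applied to `g(z) = ξ(½ − h + z, χ)/ξ(½ + h + z, χ)` on `Re z ≥ 0`. Under `χ.RiemannHypothesis` the
denominator is zero-free (`Re ≥ ½ + h > ½`, `dirichletXi_ne_zero_of_rh`); `|g| = 1` on `Re z = 0`;
`g(x) → 0` along the reals (`Γ(u) ≤ (u + h − 1)^{−h} Γ(u + h)` by log-convexity); and the growth bound
`|g(z)| ≤ exp(B|z|^{3/2})` needs a LOWER bound for `|L(σ + it, χ)|` on `½ + h ≤ σ ≤ 2`, which under the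
hypothesis comes from the **Borel–Carathéodory theorem** (Mathlib `Complex.borelCaratheodory`) applied to
a holomorphic branch of `log L(·, χ)` (tree `InvZetaRH.exists_log_of_ball`) on the discs
`|z − (2 + it)| < 3/2 − h/2 ⊂ {Re z > ½}`: `Re log L = log|L| ≤ log(qZ(|t| + 4))` (MV Lemma 10.15,
`DirichletZFR.norm_LFunction_le_of_re_ge`) and `|log L(2 + it, χ)| ≤ 5`, whence
`1/|L(σ + it, χ)| ≤ exp(A (log(|t| + 4) + 1))` with `A = O(1/h)` — polynomial growth in `t`, which is all
Phragmén–Lindelöf needs (Titchmarsh §14.2 uses the same device, plus three circles, to get `t^ε` for `ζ`;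
the three-circles refinement is not needed here). For `h ≥ ½` the statement is part (1)
(`lagarias2005_lemma_5_1_1_holds`). Theorem 5.1 (2) then follows word for word as Theorem 5.1 (1)
(`diffXiChar_zeroPattern`): hypothesis (2.6) for `E_{h,θ}(·, χ)`, de Branges' lemma
(`lagarias2005_lemma_2_2_zeros`, `lagarias2005_lemma_2_2_interlace_holds`), simplicity from
`E_{h,θ}(½ + it, χ) ≠ 0` (now by the hypothesis), and `h < 0` via `diffXiCharArot_neg` / `diffXiCharBrot_neg`.

## Main results

* `lagarias2005_lemma_5_1_2_holds`, `lagarias2005_thm_5_1_2_holds` — the two discharges (binder kept).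
* `Lagarias2005Char.exists_norm_LFunction_ge_exp_neg_of_rh` — under `χ.RiemannHypothesis`,
  `exp(−A(log(|t|+4)+1)) ≤ |L(σ+it, χ)|` for `½ + h ≤ σ ≤ 2` (Borel–Carathéodory).
* `Lagarias2005Char.exists_exp_neg_le_norm_dirichletXi_of_rh`, `Lagarias2005Char.norm_dirichletXi_shift_lt_of_rh`,
  `Lagarias2005Char.norm_dirichletXi_sub_lt_norm_dirichletXi_add_of_rh`, `diffXiChar_zeroPattern_of_rh`.
* RH-FREE tools: `Lagarias2005Char.LFunction_ne_zero_of_rh`/`dirichletXi_ne_zero_of_rh` (zero-freeness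
  on `Re > ½` from the hypothesis), `Lagarias2005Char.norm_log_LFunction_two_add_le`.

## References

* [Lagarias2005] J. C. Lagarias, Acta Arith. 120 (2005) 159–184 = arXiv:math/0601653, §5: Lemma 5.1 (2),
  Theorem 5.1 (2) (arXiv p. 10).
* [Titchmarsh1986] E. C. Titchmarsh, *The Theory of the Riemann Zeta-Function*, 2nd ed., §14.2
  (Borel–Carathéodory applied to `log ζ` under RH).
* [MontgomeryVaughan2007] H. L. Montgomery, R. C. Vaughan, *Multiplicative Number Theory I*, CUP 2007,
  (10.19), Cor. 10.8, Lemma 10.15.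
-/

noncomputable section

open scoped ComplexConjugate Real Topology
open Complex Filter Set Asymptotics Metric

namespace Literature.NumberTheory.LFunctions

open DirichletTheta
open Literature.Analysis.DeBrangesSpaces.DeBranges1986 (norm_dirichletXi_eq abs_log_norm_Gamma_le
  norm_dirichletXi_one_sub_conj)
open DirichletZFR (norm_LFunction_le_of_re_ge norm_LFunction_ge one_le_tsum_rpow)
open ZetaClassicalRegion (norm_LSeries_le_of_norm_le_one)
open ExplicitPsiChar (charNontrivialZeros mem_charNontrivialZeros)

namespace Lagarias2005Char

variable {q : ℕ} [NeZero q] {χ : DirichletCharacter ℂ q}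

/-! ## Zero-freeness on `Re s > ½` from the hypothesis -/

/-- Under the Riemann hypothesis for `L(s, χ)` (`χ ≠ 1`): `L(s, χ) ≠ 0` for `Re s > ½` (on `Re s ≥ 1`
unconditionally, Mathlib `DirichletCharacter.LFunction_ne_zero_of_one_le_re`).
[cite: Lagarias2005, Lemma 5.1 (2) (arXiv p. 10): "Assuming the Riemann hypothesis holds for ξ(s,χ)"] -/
theorem LFunction_ne_zero_of_rh (h1 : χ ≠ 1) (hG : χ.RiemannHypothesis) {s : ℂ} (hs : 1 / 2 < s.re) :
    χ.LFunction s ≠ 0 := by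
  intro h0
  rcases le_or_gt 1 s.re with hle | hlt
  · exact DirichletCharacter.LFunction_ne_zero_of_one_le_re χ (Or.inl h1) hle h0
  · have := hG s h0 (by linarith) hlt
    linarith

/-- Under the Riemann hypothesis for `L(s, χ)` (`χ` primitive, `χ ≠ 1`): `ξ(s, χ) ≠ 0` for `Re s > ½`.
[cite: Lagarias2005, Lemma 5.1 (2) (arXiv p. 10)] -/
theorem dirichletXi_ne_zero_of_rh (hχ : χ.IsPrimitive) (h1 : χ ≠ 1) (hG : χ.RiemannHypothesis)
    {s : ℂ} (hs : 1 / 2 < s.re) : dirichletXi χ s ≠ 0 := by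
  intro h0
  obtain ⟨hL, h0re, h1re⟩ := mem_charNontrivialZeros.1
    ((dirichletXi_eq_zero_iff_mem_charNontrivialZeros hχ h1 s).1 h0)
  have := hG s hL h0re h1re
  linarith

/-! ## `L(s, χ)` at the centres `2 + it` and on the discs -/

/-- `½ ≤ |L(s, χ)| ≤ 2` for `Re s = 2`. [cite: MontgomeryVaughan2007, Lemma 11.1 (proof)] -/
private theorem norm_LFunction_two_add_bounds (s : ℂ) (hs : s.re = 2) :
    1 / 2 ≤ ‖χ.LFunction s‖ ∧ ‖χ.LFunction s‖ ≤ 2 := by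
  have hs1 : 1 < s.re := by rw [hs]; norm_num
  constructor
  · refine le_trans ?_ (norm_LFunction_ge χ hs1)
    rw [hs]; norm_num
  · rw [DirichletCharacter.LFunction_eq_LSeries χ hs1]
    refine (norm_LSeries_le_of_norm_le_one (fun n ↦ DirichletCharacter.norm_le_one χ _) hs1).trans ?_
    rw [hs]; norm_num

/-- `‖log L(s, χ)‖ ≤ 5` for `Re s = 2` (`|log|L|| ≤ log 2 ≤ 1`, `|arg| ≤ π ≤ 4`).
[cite: Titchmarsh1986, §14.2 (the bound for log ζ(2+it))] -/
theorem norm_log_LFunction_two_add_le (s : ℂ) (hs : s.re = 2) : ‖Complex.log (χ.LFunction s)‖ ≤ 5 := by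
  obtain ⟨hlo, hhi⟩ := norm_LFunction_two_add_bounds (χ := χ) s hs
  have hpos : 0 < ‖χ.LFunction s‖ := by linarith
  have hlog2 : Real.log 2 ≤ 1 := by
    have := Real.log_le_sub_one_of_pos (by norm_num : (0 : ℝ) < 2); linarith
  have hre : |(Complex.log (χ.LFunction s)).re| ≤ 1 := by
    rw [Complex.log_re, abs_le]
    constructor
    · have h1 : Real.log (1 / 2) ≤ Real.log ‖χ.LFunction s‖ := Real.log_le_log (by norm_num) hlo
      rw [one_div, Real.log_inv] at h1
      linarith
    · have h2 : Real.log ‖χ.LFunction s‖ ≤ Real.log 2 := Real.log_le_log hpos hhi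
      linarith
  have him : |(Complex.log (χ.LFunction s)).im| ≤ 4 := by
    rw [Complex.log_im]
    exact (Complex.abs_arg_le_pi _).trans Real.pi_le_four
  linarith [Complex.norm_le_abs_re_add_abs_im (Complex.log (χ.LFunction s))]

/-! ## Borel–Carathéodory: a lower bound for `|L(σ + it, χ)|` on `½ + h ≤ σ ≤ 2` -/

/-- **Lower bound for `L(s, χ)` to the right of `½ + h` under the Riemann hypothesis for `L(s, χ)`**:
there is `A ≥ 0` (depending on `h ∈ (0, 1]` and `q`) with
`exp(−A (log(|t| + 4) + 1)) ≤ |L(σ + it, χ)|` for `½ + h ≤ σ ≤ 2`. Proof: Borel–Carathéodory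
(`Complex.borelCaratheodory`) for a holomorphic branch of `log L(·, χ)` (`InvZetaRH.exists_log_of_ball`) on
the disc `|z − (2 + it)| < 3/2 − h/2`, which lies in `Re z > ½` where `L ≠ 0` by the hypothesis; there
`Re log L = log|L| ≤ log(qZ(|t|+4)) + 1` (MV Lemma 10.15) and `|log L(2+it)| ≤ 5`, and the point `σ + it`
is at distance `2 − σ ≤ 3/2 − h` from the centre. (Titchmarsh's (14.2.2) device for `ζ`.)
[cite: Titchmarsh1986, §14.2 eq. (14.2.2)] -/
theorem exists_norm_LFunction_ge_exp_neg_of_rh (h1 : χ ≠ 1) (hG : χ.RiemannHypothesis) {h : ℝ}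
    (hh : 0 < h) (hh1 : h ≤ 1) :
    ∃ A : ℝ, 0 ≤ A ∧ ∀ s : ℂ, 1 / 2 + h ≤ s.re → s.re ≤ 2 →
      Real.exp (-(A * (Real.log (|s.im| + 4) + 1))) ≤ ‖χ.LFunction s‖ := by
  set Z : ℝ := ∑' n : ℕ, ((n + 1 : ℕ) : ℝ) ^ (-(5 / 4 : ℝ)) with hZ
  have hZ1 : 1 ≤ Z := one_le_tsum_rpow
  have hq1 : (1 : ℝ) ≤ q := by exact_mod_cast Nat.one_le_iff_ne_zero.2 (NeZero.ne q)
  set a : ℝ := Real.log q + Real.log Z + 1 with ha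
  have ha0 : 0 ≤ Real.log q + Real.log Z := add_nonneg (Real.log_nonneg hq1) (Real.log_nonneg hZ1)
  refine ⟨(6 * a + 30) / h, by positivity, fun s hs1 hs2 ↦ ?_⟩
  set t : ℝ := s.im with ht
  set c : ℂ := 2 + t * I with hc
  set R : ℝ := 3 / 2 - h / 2 with hR
  have hR0 : 0 < R := by rw [hR]; linarith
  have hL4 : 0 ≤ Real.log (|t| + 4) := Real.log_nonneg (by linarith [abs_nonneg t])
  -- the disc lies in `Re z > ½` and in `‖z‖ ≤ |t| + 4`
  have hdisc : ∀ z ∈ ball c R, 1 / 2 < z.re ∧ ‖z‖ ≤ |t| + 4 := by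
    intro z hz
    rw [mem_ball, dist_eq_norm] at hz
    have h1' := Complex.abs_re_le_norm (z - c)
    have hre : (z - c).re = z.re - 2 := by rw [hc]; simp
    rw [hre] at h1'
    have hzc : ‖z‖ ≤ ‖c‖ + ‖z - c‖ := by
      have := norm_add_le c (z - c); rwa [add_sub_cancel] at this
    have hcn : ‖c‖ ≤ 2 + |t| := by
      refine (norm_add_le _ _).trans ?_
      rw [Complex.norm_ofNat, norm_mul, Complex.norm_real, Complex.norm_I, mul_one, Real.norm_eq_abs]
    constructor
    · have := neg_abs_le (z.re - 2); linarith
    · linarith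
  have hF0 : ∀ z ∈ ball c R, χ.LFunction z ≠ 0 := fun z hz ↦
    LFunction_ne_zero_of_rh h1 hG (hdisc z hz).1
  have hdF : DifferentiableOn ℂ χ.LFunction (ball c R) :=
    (DirichletCharacter.differentiable_LFunction h1).differentiableOn
  obtain ⟨Lb, hLbd, hLbc, -, hexp⟩ := InvZetaRH.exists_log_of_ball hR0 hdF hF0
  -- `M`: a bound for `Re Lb = log |L|` on the disc
  set M : ℝ := a + Real.log (|t| + 4) with hM
  have hM0 : 0 < M := by rw [hM, ha]; linarith
  have hre : ∀ z ∈ ball c R, (Lb z).re ≤ M := by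
    intro z hz
    obtain ⟨hzre, hzn⟩ := hdisc z hz
    have hLz : ‖χ.LFunction z‖ ≤ q * Z * (|t| + 4) := by
      refine (norm_LFunction_le_of_re_ge χ h1 (by linarith)).trans ?_
      calc (q : ℝ) * ‖z‖ * Z = q * Z * ‖z‖ := by ring
        _ ≤ q * Z * (|t| + 4) := by gcongr
    have hpos : 0 < ‖χ.LFunction z‖ := norm_pos_iff.2 (hF0 z hz)
    have hrel : (Lb z).re = Real.log ‖χ.LFunction z‖ := by
      rw [← hexp z hz, Complex.norm_exp, Real.log_exp]
    rw [hrel]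
    calc Real.log ‖χ.LFunction z‖ ≤ Real.log (q * Z * (|t| + 4)) := Real.log_le_log hpos hLz
      _ = Real.log q + Real.log Z + Real.log (|t| + 4) := by
          rw [Real.log_mul (by positivity) (by positivity), Real.log_mul (by positivity) (by positivity)]
      _ ≤ M := by rw [hM, ha]; linarith
  -- Borel–Carathéodory for `f = Lb (· + c)` on `ball 0 R`
  set f : ℂ → ℂ := fun z ↦ Lb (z + c) with hf
  have hshift : ∀ z ∈ ball (0 : ℂ) R, z + c ∈ ball c R := by
    intro z hz
    rw [mem_ball, dist_eq_norm] at hz ⊢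
    simpa using hz
  have hfd : DifferentiableOn ℂ f (ball 0 R) :=
    hLbd.comp (differentiableOn_id.add_const c) hshift
  have hmaps : MapsTo f (ball 0 R) {z : ℂ | z.re ≤ M} := fun z hz ↦ hre (z + c) (hshift z hz)
  -- the point `s - c`, of norm `2 - σ ≤ 3/2 - h`
  have hsc : s - c = ((s.re - 2 : ℝ) : ℂ) := Complex.ext (by simp [hc]) (by simp [hc, ht])
  have hd : ‖s - c‖ = 2 - s.re := by
    rw [hsc, Complex.norm_real, Real.norm_eq_abs, abs_of_nonpos (by linarith)]; ring
  have hdle : ‖s - c‖ ≤ 3 / 2 - h := by rw [hd]; linarith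
  have hz0 : s - c ∈ ball (0 : ℂ) R := by
    rw [mem_ball, dist_zero_right]; linarith
  have hBC := Complex.borelCaratheodory hM0 hfd hmaps hR0 hz0
  have hf0 : ‖f 0‖ ≤ 5 := by
    simp only [hf, zero_add]
    rw [hLbc]
    exact norm_log_LFunction_two_add_le c (by rw [hc]; simp)
  have hfs : f (s - c) = Lb s := by simp only [hf, sub_add_cancel]
  rw [hfs] at hBC
  -- estimate the Borel–Carathéodory bound
  have hden : h / 2 ≤ R - ‖s - c‖ := by rw [hR]; linarith
  have hden0 : 0 < R - ‖s - c‖ := by linarith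
  have hnum1 : 2 * M * ‖s - c‖ ≤ 2 * M * (3 / 2) := by
    gcongr; linarith
  have hnum2 : ‖f 0‖ * (R + ‖s - c‖) ≤ 5 * 3 := by
    have : R + ‖s - c‖ ≤ 3 := by rw [hR]; linarith [norm_nonneg (s - c)]
    exact mul_le_mul hf0 this (by positivity) (by norm_num)
  have hLb : ‖Lb s‖ ≤ (6 * M + 30) / h := by
    calc ‖Lb s‖ ≤ 2 * M * ‖s - c‖ / (R - ‖s - c‖) + ‖f 0‖ * (R + ‖s - c‖) / (R - ‖s - c‖) := hBC
      _ ≤ 2 * M * (3 / 2) / (h / 2) + 5 * 3 / (h / 2) := by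
          gcongr
      _ = (6 * M + 30) / h := by field_simp; ring
  have hLb' : ‖Lb s‖ ≤ (6 * a + 30) / h * (Real.log (|t| + 4) + 1) := by
    refine hLb.trans ?_
    rw [hM, div_mul_eq_mul_div, div_le_div_iff_of_pos_right hh]
    have ha1 : 0 ≤ a := by rw [ha]; linarith
    nlinarith
  -- `|L s| = exp(Re Lb s) ≥ exp(−‖Lb s‖)`
  have hsball : s ∈ ball c R := by rw [mem_ball, dist_eq_norm]; linarith
  have hnorm : ‖χ.LFunction s‖ = Real.exp ((Lb s).re) := by rw [← hexp s hsball, Complex.norm_exp]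
  rw [hnorm]
  apply Real.exp_le_exp.2
  have := (abs_le.1 (Complex.abs_re_le_norm (Lb s))).1
  linarith

/-! ## The size of `ξ(s, χ)` to the right of `½ + h` under the hypothesis -/

/-- `exp(−13 ‖w‖^{3/2}) ≤ ‖Γ(w)‖` for `Re w > 0`, `‖w‖ ≥ 1` (from `DeBranges1986.abs_log_norm_Gamma_le`).
[folklore] -/
private theorem exp_neg_le_norm_Gamma' {w : ℂ} (hw : 0 < w.re) (hw1 : 1 ≤ ‖w‖) :
    Real.exp (-(13 * ‖w‖ ^ (3 / 2 : ℝ))) ≤ ‖Complex.Gamma w‖ := by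
  have hpos : 0 < ‖Complex.Gamma w‖ := norm_pos_iff.2 (Complex.Gamma_ne_zero_of_re_pos hw)
  have h := (abs_le.1 (abs_log_norm_Gamma_le hw hw1)).1
  calc Real.exp (-(13 * ‖w‖ ^ (3 / 2 : ℝ))) ≤ Real.exp (Real.log ‖Complex.Gamma w‖) :=
        Real.exp_le_exp.2 h
    _ = ‖Complex.Gamma w‖ := Real.exp_log hpos

omit [NeZero q] in
/-- `‖(s + κ)/2‖ ≥ ‖s‖/2` and `≤ ‖s‖` when `Re s ≥ 0`, `‖s‖ ≥ 1`. [folklore] -/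
private theorem norm_half_add_parity_bounds' {s : ℂ} (hs : 0 ≤ s.re) (h1 : 1 ≤ ‖s‖) :
    ‖s‖ / 2 ≤ ‖(s + charParity χ) / 2‖ ∧ ‖(s + charParity χ) / 2‖ ≤ ‖s‖ := by
  have hκ : (charParity χ : ℝ) ≤ 1 := by exact_mod_cast charParity_le_one χ
  have hκ0 : (0 : ℝ) ≤ charParity χ := (charParity χ).cast_nonneg
  constructor
  · rw [norm_div, Complex.norm_ofNat]
    gcongr
    rw [← Real.sqrt_sq (norm_nonneg s), ← Real.sqrt_sq (norm_nonneg (s + _)),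
      Complex.sq_norm, Complex.sq_norm, Complex.normSq_apply, Complex.normSq_apply]
    apply Real.sqrt_le_sqrt
    simp only [Complex.add_re, Complex.natCast_re, Complex.add_im, Complex.natCast_im, add_zero]
    nlinarith
  · rw [norm_div, Complex.norm_ofNat]
    have : ‖s + (charParity χ : ℂ)‖ ≤ ‖s‖ + 1 := by
      refine (norm_add_le _ _).trans ?_
      rw [Complex.norm_natCast]
      linarith
    linarith

/-- **Lower bound under the hypothesis**: `exp(−K‖s‖^{3/2}) ≤ |ξ(s, χ)|` for `Re s ≥ ½ + h`
(`0 < h ≤ ½`), `‖s‖ ≥ 3`, with `K` depending on `h` and `q`: on `Re s ≥ 1` this is the unconditional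
`exists_exp_neg_le_norm_dirichletXi`; on `½ + h ≤ Re s ≤ 2` the factor `L` is bounded below by
`exists_norm_LFunction_ge_exp_neg_of_rh`, `Γ` by Stirling and `(q/π)^{(σ+κ)/2} ≥ (1/4)^{(σ+κ)/2}`.
[cite: Titchmarsh1986, §14.2 with MontgomeryVaughan2007, (10.19)] -/
theorem exists_exp_neg_le_norm_dirichletXi_of_rh (h1 : χ ≠ 1) (hG : χ.RiemannHypothesis) {h : ℝ}
    (hh : 0 < h) (hh2 : h ≤ 1 / 2) :
    ∃ K : ℝ, 0 ≤ K ∧ ∀ s : ℂ, 1 / 2 + h ≤ s.re → 3 ≤ ‖s‖ →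
      Real.exp (-(K * ‖s‖ ^ (3 / 2 : ℝ))) ≤ ‖dirichletXi χ s‖ := by
  obtain ⟨K₂, hK₂0, hK₂⟩ := exists_exp_neg_le_norm_dirichletXi (χ := χ) h1
  obtain ⟨A, hA0, hA⟩ := exists_norm_LFunction_ge_exp_neg_of_rh h1 hG hh (by linarith)
  refine ⟨K₂ + (3 * A + 13 + 3), by positivity, fun s hs h3 ↦ ?_⟩
  have hx32 : 0 ≤ ‖s‖ ^ (3 / 2 : ℝ) := by positivity
  rcases le_or_gt 1 s.re with hle | hlt
  · refine (Real.exp_le_exp.2 ?_).trans (hK₂ s hle h3)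
    nlinarith
  · -- the strip part `½ + h ≤ Re s < 1`
    have hs0 : 0 < s.re := by linarith
    set x : ℝ := ‖s‖ with hx
    have hx1 : 1 ≤ x := by linarith
    have h032 : 1 ≤ x ^ (3 / 2 : ℝ) := Real.one_le_rpow hx1 (by norm_num)
    have h32 : x ≤ x ^ (3 / 2 : ℝ) := by
      have := Real.rpow_le_rpow_of_exponent_le hx1 (show (1 : ℝ) ≤ 3 / 2 by norm_num)
      rwa [Real.rpow_one] at this
    obtain ⟨hwlo, hwhi⟩ := norm_half_add_parity_bounds' (χ := χ) hs0.le hx1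
    set w : ℂ := (s + charParity χ) / 2 with hw
    have hwre : 0 < w.re := by
      rw [hw]
      simp only [Complex.div_ofNat_re, Complex.add_re, Complex.natCast_re]
      linarith [(charParity χ).cast_nonneg (α := ℝ)]
    have hw1 : 1 ≤ ‖w‖ := by linarith
    -- factor 1: `L`
    have hL : Real.exp (-(3 * A * x ^ (3 / 2 : ℝ))) ≤ ‖χ.LFunction s‖ := by
      refine (Real.exp_le_exp.2 ?_).trans (hA s hs (by linarith))
      have ht : |s.im| ≤ x := Complex.abs_im_le_norm s
      have hlog : Real.log (|s.im| + 4) ≤ |s.im| + 3 := by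
        have := Real.log_le_sub_one_of_pos (by positivity : (0 : ℝ) < |s.im| + 4); linarith
      nlinarith [mul_nonneg hA0 (by linarith : (0 : ℝ) ≤ x ^ (3 / 2 : ℝ) - 1)]
    -- factor 2: `Γ((s+κ)/2)`
    have hGa : Real.exp (-(13 * x ^ (3 / 2 : ℝ))) ≤ ‖Complex.Gamma w‖ := by
      refine (Real.exp_le_exp.2 ?_).trans (exp_neg_le_norm_Gamma' hwre hw1)
      have : ‖w‖ ^ (3 / 2 : ℝ) ≤ x ^ (3 / 2 : ℝ) := Real.rpow_le_rpow (norm_nonneg _) hwhi (by norm_num)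
      linarith
    -- factor 3: `(q/π)^{(σ+κ)/2}`
    have hP : Real.exp (-(3 * x ^ (3 / 2 : ℝ))) ≤ ((q : ℝ) / π) ^ ((s.re + charParity χ) / 2) := by
      have ha0 : 0 ≤ (s.re + charParity χ) / 2 := by
        linarith [(charParity χ).cast_nonneg (α := ℝ)]
      have ha1 : (s.re + charParity χ) / 2 ≤ x := by
        have hre : s.re ≤ ‖s‖ := Complex.re_le_norm s
        have hκ : (charParity χ : ℝ) ≤ 1 := by exact_mod_cast charParity_le_one χ
        rw [hx]; linarith
      have hq4 : (1 : ℝ) / 4 ≤ q / π := by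
        have hq1 : (1 : ℝ) ≤ q := by exact_mod_cast Nat.one_le_iff_ne_zero.2 (NeZero.ne q)
        rw [div_le_div_iff₀ (by norm_num) Real.pi_pos]
        nlinarith [Real.pi_le_four]
      have hl4 : -3 ≤ Real.log (1 / 4) := by
        rw [one_div, Real.log_inv]
        have := Real.log_le_sub_one_of_pos (by norm_num : (0 : ℝ) < 4)
        linarith
      calc Real.exp (-(3 * x ^ (3 / 2 : ℝ)))
          ≤ Real.exp (Real.log (1 / 4) * ((s.re + charParity χ) / 2)) := by
            apply Real.exp_le_exp.2
            nlinarith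
        _ = (1 / 4 : ℝ) ^ ((s.re + charParity χ) / 2) := (Real.rpow_def_of_pos (by norm_num) _).symm
        _ ≤ ((q : ℝ) / π) ^ ((s.re + charParity χ) / 2) := Real.rpow_le_rpow (by norm_num) hq4 ha0
    rw [norm_dirichletXi_eq h1 hs0]
    calc Real.exp (-((K₂ + (3 * A + 13 + 3)) * x ^ (3 / 2 : ℝ)))
        ≤ Real.exp (-((3 * A + 13 + 3) * x ^ (3 / 2 : ℝ))) := by
          apply Real.exp_le_exp.2
          nlinarith [mul_nonneg hK₂0 (by positivity : (0 : ℝ) ≤ x ^ (3 / 2 : ℝ))]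
      _ = Real.exp (-(3 * A * x ^ (3 / 2 : ℝ))) * Real.exp (-(13 * x ^ (3 / 2 : ℝ))) *
            Real.exp (-(3 * x ^ (3 / 2 : ℝ))) := by
          rw [← Real.exp_add, ← Real.exp_add]; ring_nf
      _ ≤ ‖χ.LFunction s‖ * ‖Complex.Gamma w‖ * ((q : ℝ) / π) ^ ((s.re + charParity χ) / 2) := by
          gcongr

/-! ## Decay of the quotient along the reals for `0 < h < 1` -/

/-- **`Γ(u) ≤ (u + h − 1)^{−h} Γ(u + h)`** for `u ≥ 1`, `0 < h < 1` (log-convexity of `Γ` between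
`u + h − 1` and `u + h`, and `Γ(u + h) = (u + h − 1) Γ(u + h − 1)`). [folklore] -/
private theorem real_Gamma_le_rpow_mul_Gamma_add_of_lt_one {u h : ℝ} (hu : 1 ≤ u) (hh : 0 < h)
    (hh1 : h < 1) : Real.Gamma u ≤ (u + h - 1) ^ (-h) * Real.Gamma (u + h) := by
  have hs0 : 0 < u + h - 1 := by linarith
  have hG : 0 < Real.Gamma (u + h) := Real.Gamma_pos_of_pos (by linarith)
  have hconv := Real.Gamma_mul_add_mul_le_rpow_Gamma_mul_rpow_Gamma (s := u + h - 1) (t := u + h)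
    (a := h) (b := 1 - h) hs0 (by linarith) hh (by linarith) (by ring)
  have hmid : h * (u + h - 1) + (1 - h) * (u + h) = u := by ring
  rw [hmid] at hconv
  have hrec : Real.Gamma (u + h - 1) = Real.Gamma (u + h) * (u + h - 1)⁻¹ := by
    have e := Real.Gamma_add_one hs0.ne'
    rw [show u + h - 1 + 1 = u + h by ring] at e
    rw [e, mul_comm (u + h - 1), mul_assoc, mul_inv_cancel₀ hs0.ne', mul_one]
  rw [hrec, Real.mul_rpow hG.le (inv_nonneg.2 hs0.le), Real.inv_rpow hs0.le, ← Real.rpow_neg hs0.le]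
    at hconv
  calc Real.Gamma u ≤ Real.Gamma (u + h) ^ h * (u + h - 1) ^ (-h) * Real.Gamma (u + h) ^ (1 - h) :=
        hconv
    _ = (u + h - 1) ^ (-h) * (Real.Gamma (u + h) ^ h * Real.Gamma (u + h) ^ (1 - h)) := by ring
    _ = (u + h - 1) ^ (-h) * Real.Gamma (u + h) := by
        rw [← Real.rpow_add hG, show h + (1 - h) = 1 by ring, Real.rpow_one]

/-- **`ξ(½ − h + x, χ)/ξ(½ + h + x, χ) → 0` as `x → +∞`** along the reals, for `0 < h < 1`: to the right
of `2`, `|L| ≤ 2` and `|L| ≥ ½`, the powers of `q/π` contribute `(q/π)^{−h}`, and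
`Γ(u)/Γ(u + h) ≤ (u + h − 1)^{−h}`. [folklore] -/
private theorem tendsto_dirichletXi_shift_div_atTop_of_lt_one (h1 : χ ≠ 1) {h : ℝ} (hh : 0 < h)
    (hh1 : h < 1) :
    Tendsto (fun x : ℝ ↦ dirichletXi χ ((1 / 2 : ℂ) - h + x) / dirichletXi χ ((1 / 2 : ℂ) + h + x))
      atTop (𝓝 0) := by
  set P : ℝ := (q : ℝ) / π with hP
  have hP0 : 0 < P := div_pos (Nat.cast_pos.2 (NeZero.pos q)) Real.pi_pos
  set A : ℝ := 4 * P ^ (-h) with hA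
  have hκ1 : (charParity χ : ℝ) ≤ 1 := by exact_mod_cast charParity_le_one χ
  have hκ0 : (0 : ℝ) ≤ charParity χ := (charParity χ).cast_nonneg
  have hb : ∀ x : ℝ, h + 4 ≤ x →
      ‖dirichletXi χ ((1 / 2 : ℂ) - h + x) / dirichletXi χ ((1 / 2 : ℂ) + h + x)‖ ≤
        A * ((x - h - 3 / 2) / 2) ^ (-h) := by
    intro x hx
    have hσ₁ : 2 ≤ 1 / 2 - h + x := by linarith
    have hσ₂ : 2 ≤ 1 / 2 + h + x := by linarith
    set u : ℝ := (1 / 2 - h + x + charParity χ) / 2 with hu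
    have hu1 : 1 ≤ u := by rw [hu]; linarith
    have hN : ‖dirichletXi χ ((1 / 2 : ℂ) - h + x)‖ =
        ‖χ.LFunction ((1 / 2 - h + x : ℝ) : ℂ)‖ * Real.Gamma u * P ^ u := by
      have e1 : ((1 / 2 : ℂ) - h + x) = ((1 / 2 - h + x : ℝ) : ℂ) := Complex.ext (by simp) (by simp)
      rw [e1, norm_dirichletXi_ofReal h1 (by linarith), ← hu, ← hP]
    have hD : ‖dirichletXi χ ((1 / 2 : ℂ) + h + x)‖ =
        ‖χ.LFunction ((1 / 2 + h + x : ℝ) : ℂ)‖ * Real.Gamma (u + h) * P ^ (u + h) := by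
      have e2 : ((1 / 2 : ℂ) + h + x) = ((1 / 2 + h + x : ℝ) : ℂ) := Complex.ext (by simp) (by simp)
      have huh : (1 / 2 + h + x + (charParity χ : ℝ)) / 2 = u + h := by rw [hu]; ring
      rw [e2, norm_dirichletXi_ofReal h1 (by linarith), huh, ← hP]
    have hLx : ‖χ.LFunction ((1 / 2 - h + x : ℝ) : ℂ)‖ ≤ 2 := by
      have hs : 1 < (((1 / 2 - h + x : ℝ)) : ℂ).re := by simp only [Complex.ofReal_re]; linarith
      rw [DirichletCharacter.LFunction_eq_LSeries χ hs]
      refine (norm_LSeries_le_of_norm_le_one (fun n ↦ DirichletCharacter.norm_le_one χ _) hs).trans ?_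
      simp only [Complex.ofReal_re]
      rw [div_le_iff₀ (by linarith)]
      linarith
    have hLx1 : 1 / 2 ≤ ‖χ.LFunction ((1 / 2 + h + x : ℝ) : ℂ)‖ := by
      have hs : 1 < (((1 / 2 + h + x : ℝ)) : ℂ).re := by simp only [Complex.ofReal_re]; linarith
      refine le_trans ?_ (norm_LFunction_ge χ hs)
      simp only [Complex.ofReal_re]
      rw [div_le_div_iff₀ (by norm_num) (by linarith)]
      linarith
    have hΓ := real_Gamma_le_rpow_mul_Gamma_add_of_lt_one hu1 hh hh1
    have hΓpos : 0 < Real.Gamma (u + h) := Real.Gamma_pos_of_pos (by linarith)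
    have hPu : 0 < P ^ u := Real.rpow_pos_of_pos hP0 u
    have hPu' : 0 < P ^ (u + h) := Real.rpow_pos_of_pos hP0 _
    have hs0 : 0 < u + h - 1 := by linarith
    have hr0 : 0 < (u + h - 1) ^ (-h) := Real.rpow_pos_of_pos hs0 _
    have hNle : ‖χ.LFunction ((1 / 2 - h + x : ℝ) : ℂ)‖ * Real.Gamma u * P ^ u ≤
        2 * ((u + h - 1) ^ (-h) * Real.Gamma (u + h)) * P ^ u := by
      gcongr
    have hDle : 1 / 2 * Real.Gamma (u + h) * P ^ (u + h) ≤
        ‖χ.LFunction ((1 / 2 + h + x : ℝ) : ℂ)‖ * Real.Gamma (u + h) * P ^ (u + h) := by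
      gcongr
    have hDb0 : 0 < 1 / 2 * Real.Gamma (u + h) * P ^ (u + h) := by positivity
    have hPP : P ^ (-h) * P ^ (u + h) = P ^ u := by
      rw [← Real.rpow_add hP0]; congr 1; ring
    have hkey : 2 * ((u + h - 1) ^ (-h) * Real.Gamma (u + h)) * P ^ u =
        (A * (u + h - 1) ^ (-h)) * (1 / 2 * Real.Gamma (u + h) * P ^ (u + h)) := by
      rw [hA, ← hPP]; ring
    have hux : (x - h - 3 / 2) / 2 ≤ u + h - 1 := by
      rw [hu]; linarith
    have hux0 : 0 < (x - h - 3 / 2) / 2 := by linarith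
    rw [norm_div, hN, hD]
    calc ‖χ.LFunction ((1 / 2 - h + x : ℝ) : ℂ)‖ * Real.Gamma u * P ^ u /
          (‖χ.LFunction ((1 / 2 + h + x : ℝ) : ℂ)‖ * Real.Gamma (u + h) * P ^ (u + h))
        ≤ (2 * ((u + h - 1) ^ (-h) * Real.Gamma (u + h)) * P ^ u) /
            (1 / 2 * Real.Gamma (u + h) * P ^ (u + h)) :=
          div_le_div₀ (by positivity) hNle hDb0 hDle
      _ = A * (u + h - 1) ^ (-h) := by
          rw [hkey, mul_div_assoc, div_self hDb0.ne', mul_one]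
      _ ≤ A * ((x - h - 3 / 2) / 2) ^ (-h) := by
          have hA0 : 0 ≤ A := by positivity
          refine mul_le_mul_of_nonneg_left ?_ hA0
          exact Real.rpow_le_rpow_of_nonpos hux0 hux (by linarith)
  have ht1 : Tendsto (fun x : ℝ ↦ (x - h - 3 / 2) / 2) atTop atTop := by
    have h0 := (tendsto_atTop_add_const_right atTop (-(h + 3 / 2)) tendsto_id).atTop_div_const
      (show (0 : ℝ) < 2 by norm_num)
    refine h0.congr fun x ↦ ?_
    simp only [id_eq]
    ring
  have ht2 : Tendsto (fun x : ℝ ↦ ((x - h - 3 / 2) / 2) ^ (-h)) atTop (𝓝 0) :=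
    (tendsto_rpow_neg_atTop hh).comp ht1
  have ht3 : Tendsto (fun x : ℝ ↦ A * ((x - h - 3 / 2) / 2) ^ (-h)) atTop (𝓝 0) := by
    simpa using ht2.const_mul A
  refine squeeze_zero_norm' ?_ ht3
  filter_upwards [eventually_ge_atTop (h + 4)] with x hx using hb x hx

/-! ## The shift inequality under the hypothesis -/

/-- **`|ξ(½ − h + z, χ)| < |ξ(½ + h + z, χ)|` on `Re z > 0` for `0 < h < ½`, assuming the Riemann
hypothesis for `L(s, χ)`** (`χ` primitive, `χ ≠ 1`): Phragmén–Lindelöf on `g = ξ(½−h+·, χ)/ξ(½+h+·, χ)`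
(denominator zero-free on `Re z ≥ 0` by the hypothesis; `|g| = 1` on `Re z = 0`; `g(x) → 0`; growth
`exp(B|z|^{3/2})` from `exists_norm_dirichletXi_le_exp` and `exists_exp_neg_le_norm_dirichletXi_of_rh`),
then the maximum modulus principle. The hypothesis is a binder, never asserted.
[cite: Lagarias2005, Lemma 5.1 (2) and its proof (arXiv p. 10; held text p0010 L28–72)] -/
theorem norm_dirichletXi_shift_lt_of_rh (hχ : χ.IsPrimitive) (h1 : χ ≠ 1) (hG : χ.RiemannHypothesis)
    {h : ℝ} (hh : 0 < h) (hh2 : h < 1 / 2) {z : ℂ} (hz : 0 < z.re) :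
    ‖dirichletXi χ ((1 / 2 : ℂ) - h + z)‖ < ‖dirichletXi χ ((1 / 2 : ℂ) + h + z)‖ := by
  have hne : ∀ w : ℂ, 0 ≤ w.re → dirichletXi χ ((1 / 2 : ℂ) + h + w) ≠ 0 := fun w hw ↦
    dirichletXi_ne_zero_of_rh hχ h1 hG
      (by simp only [Complex.add_re, Complex.ofReal_re, Complex.div_ofNat_re, Complex.one_re]; linarith)
  set g : ℂ → ℂ := fun w ↦ dirichletXi χ ((1 / 2 : ℂ) - h + w) / dirichletXi χ ((1 / 2 : ℂ) + h + w)
    with hg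
  have hdiff : Differentiable ℂ (dirichletXi χ) := differentiable_dirichletXi h1
  have hdiffN : Differentiable ℂ (fun w : ℂ ↦ dirichletXi χ ((1 / 2 : ℂ) - h + w)) :=
    hdiff.comp ((differentiable_const _).add differentiable_id)
  have hdiffD : Differentiable ℂ (fun w : ℂ ↦ dirichletXi χ ((1 / 2 : ℂ) + h + w)) :=
    hdiff.comp ((differentiable_const _).add differentiable_id)
  have hd : DiffContOnCl ℂ g {w : ℂ | 0 < w.re} := by
    refine ⟨hdiffN.differentiableOn.div hdiffD.differentiableOn fun w hw ↦ hne w (le_of_lt hw), ?_⟩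
    rw [closure_setOf_lt_re]
    exact hdiffN.continuous.continuousOn.div hdiffD.continuous.continuousOn fun w hw ↦ hne w hw
  obtain ⟨K₁, hK₁0, hK₁⟩ := exists_norm_dirichletXi_le_exp hχ h1
  obtain ⟨K₂, hK₂0, hK₂⟩ := exists_exp_neg_le_norm_dirichletXi_of_rh (χ := χ) h1 hG hh hh2.le
  have hnh : ‖(h : ℂ)‖ = h := by rw [Complex.norm_real, Real.norm_of_nonneg hh.le]
  have hhalf : ‖(1 / 2 : ℂ)‖ = 1 / 2 := by norm_num
  have hc : ‖((1 / 2 : ℂ) + h)‖ ≤ h + 1 / 2 := by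
    have e := norm_add_le (1 / 2 : ℂ) (h : ℂ)
    rw [hnh, hhalf] at e
    linarith
  have hc' : ‖((1 / 2 : ℂ) - h)‖ ≤ h + 1 / 2 := by
    have e := norm_sub_le (1 / 2 : ℂ) (h : ℂ)
    rw [hnh, hhalf] at e
    linarith
  have hexp : ∃ c < (2 : ℝ), ∃ B, g =O[Bornology.cobounded ℂ ⊓ 𝓟 {w : ℂ | 0 < w.re}]
      fun w ↦ Real.exp (B * ‖w‖ ^ c) := by
    refine ⟨3 / 2, by norm_num, (2 : ℝ) ^ (3 / 2 : ℝ) * (K₁ + K₂), ?_⟩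
    refine Asymptotics.IsBigO.of_bound 1 ?_
    rw [Filter.eventually_inf_principal]
    refine ((Metric.hasBasis_cobounded_compl_closedBall (0 : ℂ)).eventually_iff).2
      ⟨2 * h + 4, trivial, fun w hw hw' ↦ ?_⟩
    have hw4 : 2 * h + 4 < ‖w‖ := by
      simpa [Metric.mem_closedBall, dist_zero_right] using hw
    have hw' : 0 < w.re := hw'
    rw [one_mul, Real.norm_of_nonneg (Real.exp_pos _).le]
    have hN3 : 3 ≤ ‖(1 / 2 : ℂ) - h + w‖ := by
      have e : (1 / 2 : ℂ) - h + w = w - (-((1 / 2 : ℂ) - h)) := by ring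
      have h2 := norm_sub_norm_le w (-((1 / 2 : ℂ) - h))
      rw [norm_neg] at h2
      rw [e]; linarith
    have hNle : ‖(1 / 2 : ℂ) - h + w‖ ≤ 2 * ‖w‖ := by
      refine (norm_add_le _ _).trans ?_
      linarith
    have hD3 : 3 ≤ ‖(1 / 2 : ℂ) + h + w‖ := by
      have e : (1 / 2 : ℂ) + h + w = w - (-((1 / 2 : ℂ) + h)) := by ring
      have h2 := norm_sub_norm_le w (-((1 / 2 : ℂ) + h))
      rw [norm_neg] at h2
      rw [e]; linarith
    have hDle : ‖(1 / 2 : ℂ) + h + w‖ ≤ 2 * ‖w‖ := by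
      refine (norm_add_le _ _).trans ?_
      linarith
    have hDre : 1 / 2 + h ≤ ((1 / 2 : ℂ) + h + w).re := by
      simp only [Complex.add_re, Complex.ofReal_re, Complex.div_ofNat_re, Complex.one_re]; linarith
    have hN := hK₁ _ hN3
    have hD := hK₂ _ hDre hD3
    have h2w : (2 * ‖w‖) ^ (3 / 2 : ℝ) = (2 : ℝ) ^ (3 / 2 : ℝ) * ‖w‖ ^ (3 / 2 : ℝ) :=
      Real.mul_rpow (by norm_num) (norm_nonneg _)
    calc ‖g w‖ = ‖dirichletXi χ ((1 / 2 : ℂ) - h + w)‖ / ‖dirichletXi χ ((1 / 2 : ℂ) + h + w)‖ := norm_div _ _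
      _ ≤ Real.exp (K₁ * ‖(1 / 2 : ℂ) - h + w‖ ^ (3 / 2 : ℝ)) /
            Real.exp (-(K₂ * ‖(1 / 2 : ℂ) + h + w‖ ^ (3 / 2 : ℝ))) :=
          div_le_div₀ (Real.exp_pos _).le hN (Real.exp_pos _) hD
      _ = Real.exp (K₁ * ‖(1 / 2 : ℂ) - h + w‖ ^ (3 / 2 : ℝ) + K₂ * ‖(1 / 2 : ℂ) + h + w‖ ^ (3 / 2 : ℝ)) := by
          rw [Real.exp_neg, div_inv_eq_mul, Real.exp_add]
      _ ≤ Real.exp ((2 : ℝ) ^ (3 / 2 : ℝ) * (K₁ + K₂) * ‖w‖ ^ (3 / 2 : ℝ)) := by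
          apply Real.exp_le_exp.2
          have a := Real.rpow_le_rpow (norm_nonneg _) hNle (show (0 : ℝ) ≤ 3 / 2 by norm_num)
          have b := Real.rpow_le_rpow (norm_nonneg _) hDle (show (0 : ℝ) ≤ 3 / 2 by norm_num)
          rw [h2w] at a b
          nlinarith [mul_le_mul_of_nonneg_left a hK₁0, mul_le_mul_of_nonneg_left b hK₂0]
  have hre : Tendsto (fun x : ℝ ↦ g x) atTop (𝓝 0) :=
    tendsto_dirichletXi_shift_div_atTop_of_lt_one h1 hh (by linarith)
  have him : ∀ y : ℝ, ‖g (y * I)‖ ≤ 1 := by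
    intro y
    have heq : ‖dirichletXi χ ((1 / 2 : ℂ) - h + y * I)‖ = ‖dirichletXi χ ((1 / 2 : ℂ) + h + y * I)‖ := by
      have e : (1 : ℂ) - conj ((1 / 2 : ℂ) + h + y * I) = (1 / 2 : ℂ) - h + y * I := by
        simp only [map_add, map_mul, Complex.conj_ofReal, Complex.conj_I, map_div₀, map_one, map_ofNat]
        ring
      rw [← e, norm_dirichletXi_one_sub_conj hχ h1]
    show ‖dirichletXi χ ((1 / 2 : ℂ) - h + y * I) / dirichletXi χ ((1 / 2 : ℂ) + h + y * I)‖ ≤ 1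
    rw [norm_div, heq]
    exact div_self_le_one _
  have hle : ∀ w : ℂ, 0 ≤ w.re → ‖g w‖ ≤ 1 := fun w hw ↦
    PhragmenLindelof.right_half_plane_of_tendsto_zero_on_real hd hexp hre him hw
  have hz1 : 0 < ‖dirichletXi χ ((1 / 2 : ℂ) + h + z)‖ := norm_pos_iff.2 (hne z hz.le)
  by_contra hcon
  have hge : ‖dirichletXi χ ((1 / 2 : ℂ) + h + z)‖ ≤ ‖dirichletXi χ ((1 / 2 : ℂ) - h + z)‖ := not_lt.1 hcon
  have hgz : ‖g z‖ = 1 := by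
    refine le_antisymm (hle z hz.le) ?_
    show 1 ≤ ‖dirichletXi χ ((1 / 2 : ℂ) - h + z) / dirichletXi χ ((1 / 2 : ℂ) + h + z)‖
    rw [norm_div, le_div_iff₀ hz1, one_mul]
    exact hge
  have hU : IsOpen {w : ℂ | 0 < w.re} := isOpen_lt continuous_const Complex.continuous_re
  have hUc : IsPreconnected {w : ℂ | 0 < w.re} := (convex_halfSpace_re_gt 0).isPreconnected
  have hmax : IsMaxOn (norm ∘ g) {w : ℂ | 0 < w.re} z := fun w hw ↦ by
    simp only [Set.mem_setOf_eq, Function.comp_apply, hgz]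
    exact hle w (le_of_lt hw)
  have heq := Complex.eqOn_of_isPreconnected_of_isMaxOn_norm hUc hU hd.differentiableOn hz hmax
  have hev : ∀ᶠ x : ℝ in atTop, ‖g x‖ < 1 / 2 := by
    have hn := hre.norm
    rw [norm_zero] at hn
    exact hn.eventually (gt_mem_nhds (by norm_num))
  obtain ⟨x, hx1, hx2⟩ := (hev.and (eventually_gt_atTop 0)).exists
  have hxU : (x : ℂ) ∈ {w : ℂ | 0 < w.re} := by
    simpa only [Set.mem_setOf_eq, Complex.ofReal_re] using hx2
  have hgx : g x = g z := heq hxU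
  rw [hgx, hgz] at hx1
  linarith

/-- **`|ξ(s − h, χ)| < |ξ(s + h, χ)|` for `Re s > ½` and every `h > 0`, assuming the Riemann hypothesis
for `L(s, χ)`** (`χ` primitive, `χ ≠ 1`; for `h ≥ ½` unconditionally,
`norm_dirichletXi_sub_lt_norm_dirichletXi_add`). The hypothesis is a binder, never asserted.
[cite: Lagarias2005, Lemma 5.1 (2) (arXiv p. 10; held text p0010 L28–36)] -/
theorem norm_dirichletXi_sub_lt_norm_dirichletXi_add_of_rh (hχ : χ.IsPrimitive) (h1 : χ ≠ 1)
    (hG : χ.RiemannHypothesis) {h : ℝ} (hh : 0 < h) {s : ℂ} (hs : 1 / 2 < s.re) :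
    ‖dirichletXi χ (s - h)‖ < ‖dirichletXi χ (s + h)‖ := by
  rcases le_or_gt (1 / 2 : ℝ) h with hh2 | hh2
  · exact norm_dirichletXi_sub_lt_norm_dirichletXi_add hχ h1 hh2 hs
  · have hz : 0 < (s - 1 / 2).re := by
      simp only [Complex.sub_re, Complex.div_ofNat_re, Complex.one_re]; linarith
    have key := norm_dirichletXi_shift_lt_of_rh hχ h1 hG hh hh2 hz
    have e1 : (1 / 2 : ℂ) - h + (s - 1 / 2) = s - h := by ring
    have e2 : (1 / 2 : ℂ) + h + (s - 1 / 2) = s + h := by ring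
    rwa [e1, e2] at key

end Lagarias2005Char

/-! ## Lemma 5.1 (2) and Theorem 5.1 (2) -/

section Dirichlet

open Lagarias2005Char

variable {N : ℕ} [NeZero N] {χ : DirichletCharacter ℂ N}

/-- **Lagarias 2005, Lemma 5.1 (2)** — discharge of `lagarias2005_lemma_5_1_2` (GRH(χ)-CONDITIONAL; the
hypothesis "the Riemann hypothesis holds for `ξ(s, χ)`" is the binder `χ.RiemannHypothesis`, kept): for a
primitive non-principal `χ` satisfying it and every `h > 0`, `|E_h(s, χ)| > |E_h(1 − s̄, χ)|` on
`Re(s) > ½`. Printed proof: zero by zero in the Hadamard product (5.4) with `β = ½`; proved here by the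
Phragmén–Lindelöf + Borel–Carathéodory road (`Lagarias2005Char.norm_dirichletXi_shift_lt_of_rh`).
[cite: Lagarias2005, Lemma 5.1 (2) (arXiv p. 10; held text p0010 L28–36)] -/
theorem lagarias2005_lemma_5_1_2_holds : lagarias2005_lemma_5_1_2 := by
  intro N _ χ hχ h1 hG h hh s hs
  rw [norm_diffXiCharE_one_sub_conj hχ h1, diffXiCharE_apply]
  exact norm_dirichletXi_sub_lt_norm_dirichletXi_add_of_rh hχ h1 hG hh hs

/-- `E_{h,θ}(·, χ)` satisfies hypothesis (2.6) of Lemma 2.2 for every `h > 0` under the Riemann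
hypothesis for `L(s, χ)` (binder kept). [cite: Lagarias2005, Theorem 5.1 (2), proof (arXiv p. 10)] -/
theorem diffXiCharErot_critHB_of_rh (hχ : χ.IsPrimitive) (h1 : χ ≠ 1) (hG : χ.RiemannHypothesis)
    {h : ℝ} (hh : 0 < h) (θ : ℝ) :
    ∀ s : ℂ, 1 / 2 < s.re → ‖diffXiCharErot χ h θ (1 - conj s)‖ < ‖diffXiCharErot χ h θ s‖ := by
  intro s hs
  have key := lagarias2005_lemma_5_1_2_holds N χ hχ h1 hG h hh s hs
  have hθ : ‖Complex.exp (θ * I)‖ = 1 := by rw [Complex.norm_exp]; simp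
  rw [diffXiCharErot_apply, diffXiCharErot_apply, norm_mul, norm_mul, hθ, one_mul, one_mul]
  exact key

/-- `E_{h,θ}(½ + it, χ) ≠ 0` for `h > 0` under the Riemann hypothesis for `L(s, χ)`
(`Re(½ + h + it) > ½`). [cite: Lagarias2005, Theorem 5.1 (2), proof (arXiv p. 10)] -/
theorem diffXiCharErot_critLine_ne_zero_of_rh (hχ : χ.IsPrimitive) (h1 : χ ≠ 1)
    (hG : χ.RiemannHypothesis) {h : ℝ} (hh : 0 < h) (θ t : ℝ) :
    diffXiCharErot χ h θ (1 / 2 + t * I) ≠ 0 := by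
  rw [diffXiCharErot_apply, diffXiCharE_apply]
  refine mul_ne_zero (Complex.exp_ne_zero _) (dirichletXi_ne_zero_of_rh hχ h1 hG ?_)
  simp only [Complex.add_re, Complex.div_ofNat_re, Complex.one_re, Complex.mul_re, Complex.ofReal_re,
    Complex.I_re, Complex.ofReal_im, Complex.I_im, mul_zero, mul_one, sub_self, add_zero]
  linarith

/-- A point with `Re s = ½` is `½ + i·Im s`. [folklore] -/
private theorem eq_critLine_of_re'' {s : ℂ} (hs : s.re = 1 / 2) : s = 1 / 2 + (s.im : ℝ) * I :=
  Complex.ext (by simp [hs]) (by simp)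

/-- **Theorem 5.1 for every `h > 0` and real `θ` under the Riemann hypothesis for `L(s, χ)`** (binder
kept): the zeros of `A_{h,θ}(·, χ)`, `B_{h,θ}(·, χ)` lie on the critical line, are simple, and interlace
— the assembly of `diffXiChar_zeroPattern` with Lemma 5.1 (2) in place of Lemma 5.1 (1).
[cite: Lagarias2005, Theorem 5.1 (2), proof (arXiv p. 10; held text p0010 L85–104)] -/
theorem diffXiChar_zeroPattern_of_rh (hχ : χ.IsPrimitive) (h1 : χ ≠ 1) (hG : χ.RiemannHypothesis)
    {h : ℝ} (hh : 0 < h) (θ : ℝ) :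
    AllZerosOnCriticalLine (diffXiCharArot χ h θ) ∧ AllZerosOnCriticalLine (diffXiCharBrot χ h θ) ∧
      AllZerosSimple (diffXiCharArot χ h θ) ∧ AllZerosSimple (diffXiCharBrot χ h θ) ∧
        CritZerosInterlace (diffXiCharArot χ h θ) (diffXiCharBrot χ h θ) := by
  have hE : Differentiable ℂ (diffXiCharErot χ h θ) := differentiable_diffXiCharErot h1 h θ
  have hHB := diffXiCharErot_critHB_of_rh hχ h1 hG hh θ
  obtain ⟨hA, hB⟩ := lagarias2005_lemma_2_2_zeros hHB
  have hA' : AllZerosOnCriticalLine (diffXiCharArot χ h θ) := hA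
  have hB' : AllZerosOnCriticalLine (diffXiCharBrot χ h θ) := hB
  refine ⟨hA', hB', ?_, ?_, lagarias2005_lemma_2_2_interlace_holds _ hE hHB⟩
  · intro s h0
    have hs : s = 1 / 2 + (s.im : ℝ) * I := eq_critLine_of_re'' (hA' s h0)
    rw [hs] at h0 ⊢
    exact deriv_critRePart_ne_zero_of_ne hE hHB (diffXiCharErot_critLine_ne_zero_of_rh hχ h1 hG hh θ s.im) h0
  · intro s h0
    have hs : s = 1 / 2 + (s.im : ℝ) * I := eq_critLine_of_re'' (hB' s h0)
    rw [hs] at h0 ⊢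
    exact deriv_critImPart_ne_zero_of_ne hE hHB (diffXiCharErot_critLine_ne_zero_of_rh hχ h1 hG hh θ s.im) h0

/-- Negating a function preserves "all zeros on the critical line". [folklore] -/
private theorem allZerosOnCriticalLine_neg'' {F : ℂ → ℂ} (hF : AllZerosOnCriticalLine F) :
    AllZerosOnCriticalLine (-F) := fun s hs ↦ hF s (by simpa using hs)

/-- Negating a function preserves "all zeros simple". [folklore] -/
private theorem allZerosSimple_neg'' {F : ℂ → ℂ} (hF : AllZerosSimple F) : AllZerosSimple (-F) := by
  intro s hs
  rw [deriv.neg]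
  exact neg_ne_zero.2 (hF s (by simpa using hs))

/-- Negating a function does not change its critical-line zero counts. [folklore] -/
private theorem critZeroCountOn_neg'' (F : ℂ → ℂ) (S : Set ℝ) :
    critZeroCountOn (-F) S = critZeroCountOn F S := by
  have h1 : critZeroOrdinates (-F) = critZeroOrdinates F := by
    ext t; simp [critZeroOrdinates]
  simp [critZeroCountOn, h1, analyticOrderNatAt, analyticOrderAt_neg]

/-- Negating the second function preserves interlacing. [folklore] -/
private theorem critZerosInterlace_neg_right'' {F G : ℂ → ℂ} (hFG : CritZerosInterlace F G) :
    CritZerosInterlace F (-G) := by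
  intro t₁ t₂ ht
  rw [critZeroCountOn_neg'']
  exact hFG t₁ t₂ ht

/-- **Lagarias 2005, Theorem 5.1 (2)** — discharge of `lagarias2005_thm_5_1_2` (GRH(χ)-CONDITIONAL, binder
kept): assuming the Riemann hypothesis for `L(s, χ)` (`χ` primitive, non-principal), for `0 < |h| < ½`
and `0 ≤ θ < 2π` the zeros of `A_{h,θ}(s, χ)`, `B_{h,θ}(s, χ)` lie on `Re(s) = ½`, are simple, and
interlace. For `h > 0`: `diffXiChar_zeroPattern_of_rh`; for `h < 0`: `A_{h,θ} = A_{−h,θ′}`,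
`B_{h,θ} = −B_{−h,θ′}` (`diffXiCharArot_neg`, `diffXiCharBrot_neg`).
[cite: Lagarias2005, Theorem 5.1 (2) (arXiv p. 10; held text p0010 L85–104)] -/
theorem lagarias2005_thm_5_1_2_holds : lagarias2005_thm_5_1_2 := by
  intro N _ χ hχ h1 hG h θ hh _ _ _
  rcases le_or_gt 0 h with h0 | h0
  · rw [abs_of_nonneg h0] at hh
    exact diffXiChar_zeroPattern_of_rh hχ h1 hG hh θ
  · have hh' : 0 < -h := by linarith
    obtain ⟨hA, hB, hsA, hsB, hI⟩ :=
      diffXiChar_zeroPattern_of_rh hχ h1 hG hh' (-θ - Complex.arg χ.rootNumber)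
    have eA : diffXiCharArot χ h θ = diffXiCharArot χ (-h) (-θ - Complex.arg χ.rootNumber) := by
      rw [← diffXiCharArot_neg hχ h1, neg_neg]
    have eB : diffXiCharBrot χ h θ = -diffXiCharBrot χ (-h) (-θ - Complex.arg χ.rootNumber) := by
      rw [← diffXiCharBrot_neg hχ h1, neg_neg]
    rw [eA, eB]
    exact ⟨hA, allZerosOnCriticalLine_neg'' hB, hsA, allZerosSimple_neg'' hsB,
      critZerosInterlace_neg_right'' hI⟩

end Dirichlet

end Literature.NumberTheory.LFunctions
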